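import Mathlib
import HarnessLib
import HarnessLib.Audit
import Summits.Langlands.Statement
import Summits.Langlands.Langlands.Theses.ParahoricFibre
import Literature.NumberTheory.GaloisRepresentations.OrdinaryRegular
import Literature.NumberTheory.GaloisRepresentations.LocalClassFieldTheory
import Literature.NumberTheory.GaloisRepresentations.LocalArtinMapPinned
import Summits.Langlands.Langlands.Theses.OrdinaryLocusCarving

/-! # BC3 birth skeleton (pre-birth twin: carries verbatim copies of the cell and of the stub statements; `Iff.rfl` to the route decl once born) for
`OrdinaryLocusCarving.NonOrdinaryParahoricOccurrence` (rank 3).  NAMED stubs = the parent crux's REGISTERED skeleton `Cruxes/ParahoricOccurrence/Lines/birth.lean` re-homed to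
the cell: stub 1 (Iwahori occurrence, KNOWN), stub 2∣cell (the patching datum with the dial inserted — the cell's open content), stub 3 (Flath, KNOWN);
`NonOrdinaryParahoricOccurrence_of` is the parent's composition, kernel-checked (sorries ONLY inside `stub_*`). -/

set_option linter.dupNamespace false
set_option linter.unusedVariables false

namespace Summit.Langlands.Langlands.Theses.OrdinaryLocusCarving.Birth.NonOrdinaryParahoricOccurrence

open scoped BigOperators Topology Manifold Classical MeasureTheory ProbabilityTheory Matrix InnerProductSpace ComplexConjugate ContinuousMap NumberField
open Filter Set Function TopologicalSpace MeasureTheory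

/-- verbatim copy of the cell `NonOrdinaryParahoricOccurrence` (texts.json; = the route decl by `Iff.rfl` after birth). -/
def NonOrdinaryParahoricOccurrence : Prop :=
  open IsDedekindDomain NumberField Polynomial Filter Literature.NumberTheory.Automorphic Literature.NumberTheory.GaloisRepresentations in ∀ (K : Type) [Field K] [NumberField K], NumberField.IsCMField K → ∀ (n : ℕ) (hcpt : isCompact_glFiniteIntegralLevel n K) (π : CuspidalAutomorphicRepData n K hcpt), π.1.IsRegularAlgebraic → ∀ (p : ℕ) [Fact p.Prime] (ι : PadicAlgCl p ≃+* ℂ) (ρ : FramedGaloisRep K (PadicAlgCl p) n), ρ.toGaloisRep.IsSemisimple → (∀ᶠ v : HeightOneSpectrum (𝓞 K) in cofinite, ∀ α : Multiset ℂ, π.1.HasSatakeParamAt v α → ρ.IsUnramifiedAt v ∧ ρ.HasFrobCharpolyAt v (arithFrobPolyOfSatake ι v.residueCard n α)) → n ^ 2 < p → ¬ ((p : ℤ) ∣ NumberField.discr K) → (∀ w : HeightOneSpectrum (𝓞 K), ((p : ℕ) : 𝓞 K) ∈ w.asIdeal → π.1.IsUnramifiedAt w) → ¬ (∀ w : HeightOneSpectrum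 (𝓞 K), ((p : ℕ) : 𝓞 K) ∈ w.asIdeal → ∀ art : LocalArtinData (w.adicCompletion K), art.IsCanonical → ρ.IsOrdinaryRegularAt w art) → ∀ g : GL (Fin n) (PadicAlgCl p), (∀ (σ : Field.absoluteGaloisGroup K) (i j : Fin n), ‖((g * ρ σ * g⁻¹ : GL (Fin n) (PadicAlgCl p)) : Matrix (Fin n) (Fin n) (PadicAlgCl p)) i j‖ ≤ 1) → (∀ M : Matrix (Fin n) (Fin n) ℤ, M.det = 1 → ∃ σ : Field.absoluteGaloisGroup K, ∀ i j : Fin n, ‖((g * ρ σ * g⁻¹ : GL (Fin n) (PadicAlgCl p)) : Matrix (Fin n) (Fin n) (PadicAlgCl p)) i j - ((M i j : ℤ) : PadicAlgCl p)‖ < 1) → (∃ l : ℕ, l.Prime ∧ l ≠ p ∧ ∀ w : HeightOneSpectrum (𝓞 K), ((l : ℕ) : 𝓞 K) ∈ w.asIdeal → w.residueCard = l ∧ ρ.IsUnramifiedAt w ∧ ∃ a : Fin n → PadicAlgCl p, ρ.HasFrobCharpolyAt w (∏ i, (X - C (a i))) ∧ ∀ i j : Fin n, i ≠ j → ‖a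 i - a j‖ = 1 ∧ ‖a i - (l : PadicAlgCl p) * a j‖ = 1) → ∀ v : HeightOneSpectrum (𝓞 K), ((p : ℕ) : 𝓞 K) ∉ v.asIdeal → p ∣ (v.residueCard - 1) → (∀ (σ : Field.absoluteGaloisGroup (v.adicCompletion K)) (i j : Fin n), ‖((g * ρ.toLocal v σ * g⁻¹ : GL (Fin n) (PadicAlgCl p)) : Matrix (Fin n) (Fin n) (PadicAlgCl p)) i j - (1 : Matrix (Fin n) (Fin n) (PadicAlgCl p)) i j‖ < 1) → (∀ σ ∈ absInertia (v.adicCompletion K), (((ρ.toLocal v σ : GL (Fin n) (PadicAlgCl p)) : Matrix (Fin n) (Fin n) (PadicAlgCl p)) - 1) ^ n = 0) → ∀ W : WeilDeligneRep (v.adicCompletion K) (PadicAlgCl p) (Fin n → PadicAlgCl p), IsWeilDeligneOfLadic (ρ.toLocal v).toWeilGroupHom W → ∃ πv : SmoothIrrep (GL (Fin n) (v.adicCompletion K)), π.1.HasLocalComponentAt v πv.ρ ∧ ∃ x : πv.V, x ≠ 0 ∧ ∀ g₁ : GL (Fin n) (v.adicCompletion K), (∀ i j : Fin n, Valued.v ((g₁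 : Matrix (Fin n) (Fin n) (v.adicCompletion K)) i j) ≤ 1) → Valued.v (g₁ : Matrix (Fin n) (Fin n) (v.adicCompletion K)).det = 1 → (∀ i j : Fin n, (Finset.univ.filter fun t : Fin n => n ≤ j.val + Module.finrank (PadicAlgCl p) (LinearMap.range (W.N ^ (t.val + 1)))).card < (Finset.univ.filter fun t : Fin n => n ≤ i.val + Module.finrank (PadicAlgCl p) (LinearMap.range (W.N ^ (t.val + 1)))).card → Valued.v ((g₁ : Matrix (Fin n) (Fin n) (v.adicCompletion K)) i j) < 1) → πv.ρ g₁ x = x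

/-- stub 1 of the parent skeleton VERBATIM — KNOWN in print (Varma 2024 ss-compatibility + Borel 1976 + Flath): unipotent inertia at v ⇒ a global vector fixed modulo W′ by the Iwahori at v. -/
theorem stub_iwahoriOccurrence :
    open IsDedekindDomain NumberField Polynomial Filter Literature.NumberTheory.Automorphic Literature.NumberTheory.GaloisRepresentations Summit.Langlands in ∀ (K : Type) [Field K] [NumberField K], NumberField.IsCMField K → ∀ (n : ℕ) (hcpt : isCompact_glFiniteIntegralLevel n K) (π : CuspidalAutomorphicRepData n K hcpt), π.1.IsRegularAlgebraic → ∀ (p : ℕ) [Fact p.Prime] (ι : PadicAlgCl p ≃+* ℂ) (ρ : FramedGaloisRep K (PadicAlgCl p) n), ρ.toGaloisRep.IsSemisimple → (∀ᶠ v : HeightOneSpectrum (𝓞 K) in cofinite, ∀ α : Multiset ℂ, π.1.HasSatakeParamAt v α → ρ.IsUnramifiedAt v ∧ ρ.HasFrobCharpolyAt v (arithFrobPolyOfSatake ι v.residueCard n α)) → ∀ v : HeightOneSpectrum (𝓞 K), ((p : ℕ) : 𝓞 K) ∉ v.asIdeal → (∀ σ ∈ absInertia (v.adicCompletion K), (((ρ.toLocal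 v σ : GL (Fin n) (PadicAlgCl p)) : Matrix (Fin n) (Fin n) (PadicAlgCl p)) - 1) ^ n = 0) → ∃ φ ∈ π.1.W, φ ∉ π.1.W' ∧ ∀ g₁ : GL (Fin n) (v.adicCompletion K), (∀ i j : Fin n, Valued.v ((g₁ : Matrix (Fin n) (Fin n) (v.adicCompletion K)) i j) ≤ 1) → Valued.v (g₁ : Matrix (Fin n) (Fin n) (v.adicCompletion K)).det = 1 → (∀ i j : Fin n, j < i → Valued.v ((g₁ : Matrix (Fin n) (Fin n) (v.adicCompletion K)) i j) < 1) → rightTranslation (AdelicGroupData.gl n K) (GLn.ofLocal n K v g₁) φ - φ ∈ π.1.W' := by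
  sorry

/-- stub 2∣NONORD — the parent's registered open stub with ¬ORD inserted: the DECLARED RESIDUAL's open core (non-ordinary fixed-weight patching with level raising at v; head-on `Literature.Barriers.Langlands.FamilyWitnessConsecutiveWeights`; IDEA-NEEDED; print sub-box n = 2, weight 0: Allen–Newton arXiv:1901.05490). -/
theorem stub_nonOrdinaryParahoricPatchingDatum :
    open IsDedekindDomain NumberField Polynomial Filter Literature.NumberTheory.Automorphic Literature.NumberTheory.GaloisRepresentations Summit.Langlands in ∀ (K : Type) [Field K] [NumberField K], NumberField.IsCMField K → ∀ (n : ℕ) (hcpt : isCompact_glFiniteIntegralLevel n K) (π : CuspidalAutomorphicRepData n K hcpt), π.1.IsRegularAlgebraic → ∀ (p : ℕ) [Fact p.Prime] (ι : PadicAlgCl p ≃+* ℂ) (ρ : FramedGaloisRep K (PadicAlgCl p) n), ρ.toGaloisRep.IsSemisimple → (∀ᶠ v : HeightOneSpectrum (𝓞 K) in cofinite, ∀ α : Multiset ℂ, π.1.HasSatakeParamAt v α → ρ.IsUnramifiedAt v ∧ ρ.HasFrobCharpolyAt v (arithFrobPolyOfSatake ι v.residueCard n α)) → n ^ 2 < p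 → ¬ ((p : ℤ) ∣ NumberField.discr K) → (∀ w : HeightOneSpectrum (𝓞 K), ((p : ℕ) : 𝓞 K) ∈ w.asIdeal → π.1.IsUnramifiedAt w) → ¬ (∀ w : HeightOneSpectrum (𝓞 K), ((p : ℕ) : 𝓞 K) ∈ w.asIdeal → ∀ art : LocalArtinData (w.adicCompletion K), art.IsCanonical → ρ.IsOrdinaryRegularAt w art) → ∀ g : GL (Fin n) (PadicAlgCl p), (∀ (σ : Field.absoluteGaloisGroup K) (i j : Fin n), ‖((g * ρ σ * g⁻¹ : GL (Fin n) (PadicAlgCl p)) : Matrix (Fin n) (Fin n) (PadicAlgCl p)) i j‖ ≤ 1) → (∀ M : Matrix (Fin n) (Fin n) ℤ, M.det = 1 → ∃ σ : Field.absoluteGaloisGroup K, ∀ i j : Fin n, ‖((g * ρ σ * g⁻¹ : GL (Fin n) (PadicAlgCl p)) : Matrix (Fin n) (Fin n) (PadicAlgCl p)) i j - ((M i j : ℤ) : PadicAlgCl p)‖ < 1) → (∃ l : ℕ, l.Prime ∧ l ≠ p ∧ ∀ w : HeightOneSpectrum (𝓞 K), ((l : ℕ) : 𝓞 K) ∈ w.asIdeal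 → w.residueCard = l ∧ ρ.IsUnramifiedAt w ∧ ∃ a : Fin n → PadicAlgCl p, ρ.HasFrobCharpolyAt w (∏ i, (X - C (a i))) ∧ ∀ i j : Fin n, i ≠ j → ‖a i - a j‖ = 1 ∧ ‖a i - (l : PadicAlgCl p) * a j‖ = 1) → ∀ v : HeightOneSpectrum (𝓞 K), ((p : ℕ) : 𝓞 K) ∉ v.asIdeal → p ∣ (v.residueCard - 1) → (∀ (σ : Field.absoluteGaloisGroup (v.adicCompletion K)) (i j : Fin n), ‖((g * ρ.toLocal v σ * g⁻¹ : GL (Fin n) (PadicAlgCl p)) : Matrix (Fin n) (Fin n) (PadicAlgCl p)) i j - (1 : Matrix (Fin n) (Fin n) (PadicAlgCl p)) i j‖ < 1) → (∀ σ ∈ absInertia (v.adicCompletion K), (((ρ.toLocal v σ : GL (Fin n) (PadicAlgCl p)) : Matrix (Fin n) (Fin n) (PadicAlgCl p)) - 1) ^ n = 0) → ∀ W : WeilDeligneRep (v.adicCompletion K) (PadicAlgCl p) (Fin n → PadicAlgCl p), IsWeilDeligneOfLadic (ρ.toLocal v).toWeilGroupHom W → (∃ φ ∈ π.1.W, φ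 ∉ π.1.W' ∧ ∀ g₁ : GL (Fin n) (v.adicCompletion K), (∀ i j : Fin n, Valued.v ((g₁ : Matrix (Fin n) (Fin n) (v.adicCompletion K)) i j) ≤ 1) → Valued.v (g₁ : Matrix (Fin n) (Fin n) (v.adicCompletion K)).det = 1 → (∀ i j : Fin n, j < i → Valued.v ((g₁ : Matrix (Fin n) (Fin n) (v.adicCompletion K)) i j) < 1) → rightTranslation (AdelicGroupData.gl n K) (GLn.ofLocal n K v g₁) φ - φ ∈ π.1.W') → ∃ (R : Type) (_ : CommRing R) (_ : IsNoetherianRing R) (M : Type) (_ : AddCommGroup M) (_ : Module R M) (_ : Module.Finite R M) (𝔮 𝔭x : Ideal R) (_ : 𝔮.IsPrime) (_ : 𝔭x.IsPrime), 𝔮 ≤ 𝔭x ∧ Nontrivial (LocalizedModule 𝔮.primeCompl M) ∧ (Nontrivial (LocalizedModule 𝔭x.primeCompl M) → ∃ φ ∈ π.1.W, φ ∉ π.1.W' ∧ ∀ g₁ : GL (Fin n) (v.adicCompletion K), (∀ i j : Fin n, Valued.v ((g₁ : Matrix (Fin n) (Fin n) (v.adicCompletion K)) i j) ≤ 1) →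 Valued.v (g₁ : Matrix (Fin n) (Fin n) (v.adicCompletion K)).det = 1 → (∀ i j : Fin n, (Finset.univ.filter fun t : Fin n => n ≤ j.val + Module.finrank (PadicAlgCl p) (LinearMap.range (W.N ^ (t.val + 1)))).card < (Finset.univ.filter fun t : Fin n => n ≤ i.val + Module.finrank (PadicAlgCl p) (LinearMap.range (W.N ^ (t.val + 1)))).card → Valued.v ((g₁ : Matrix (Fin n) (Fin n) (v.adicCompletion K)) i j) < 1) → rightTranslation (AdelicGroupData.gl n K) (GLn.ofLocal n K v g₁) φ - φ ∈ π.1.W') := by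
  sorry

/-- stub 3 of the parent skeleton VERBATIM — KNOWN in print (Flath 1979): a global vector fixed mod W′ by ι_v(J) ⇒ a local component with a J-fixed vector. -/
theorem stub_localComponentOfParahoricFixed :
    open IsDedekindDomain NumberField Polynomial Filter Literature.NumberTheory.Automorphic Literature.NumberTheory.GaloisRepresentations Summit.Langlands in ∀ (K : Type) [Field K] [NumberField K] (n : ℕ) (hcpt : isCompact_glFiniteIntegralLevel n K) (π : CuspidalAutomorphicRepData n K hcpt) (v : HeightOneSpectrum (𝓞 K)) (b : Fin n → ℕ), (∃ φ ∈ π.1.W, φ ∉ π.1.W' ∧ ∀ g₁ : GL (Fin n) (v.adicCompletion K), (∀ i j : Fin n, Valued.v ((g₁ : Matrix (Fin n) (Fin n) (v.adicCompletion K)) i j) ≤ 1) → Valued.v (g₁ : Matrix (Fin n) (Fin n) (v.adicCompletion K)).det = 1 → (∀ i j : Fin n, b j < b i → Valued.v ((g₁ : Matrix (Fin n) (Fin n) (v.adicCompletion K)) i j) < 1) → rightTranslation (AdelicGroupData.gl n K) (GLn.ofLocal n K v g₁) φ - φ ∈ π.1.W') → ∃ πv : SmoothIrrep (GL (Fin n)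 (v.adicCompletion K)), π.1.HasLocalComponentAt v πv.ρ ∧ ∃ x : πv.V, x ≠ 0 ∧ ∀ g₁ : GL (Fin n) (v.adicCompletion K), (∀ i j : Fin n, Valued.v ((g₁ : Matrix (Fin n) (Fin n) (v.adicCompletion K)) i j) ≤ 1) → Valued.v (g₁ : Matrix (Fin n) (Fin n) (v.adicCompletion K)).det = 1 → (∀ i j : Fin n, b j < b i → Valued.v ((g₁ : Matrix (Fin n) (Fin n) (v.adicCompletion K)) i j) < 1) → πv.ρ g₁ x = x := by
  sorry

/-- Support is closed under specialisation (`Module.mem_support_mono`) — the parent skeleton's proved helper. [folklore] -/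
theorem nontrivial_localizedModule_of_le {R : Type*} [CommRing R] {M : Type*} [AddCommGroup M]
    [Module R M] {𝔮 𝔭 : Ideal R} [𝔮.IsPrime] [𝔭.IsPrime] (hle : 𝔮 ≤ 𝔭)
    (h : Nontrivial (LocalizedModule 𝔮.primeCompl M)) :
    Nontrivial (LocalizedModule 𝔭.primeCompl M) := by
  have h𝔮 : (⟨𝔮, inferInstance⟩ : PrimeSpectrum R) ∈ Module.support R M := h
  have h𝔭 : (⟨𝔭, inferInstance⟩ : PrimeSpectrum R) ∈ Module.support R M :=
    Module.mem_support_mono (show (⟨𝔮, inferInstance⟩ : PrimeSpectrum R) ≤ ⟨𝔭, inferInstance⟩ from hle) h𝔮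
  exact h𝔭

/-- `NonOrdinaryParahoricOccurrence` from its three stubs (kernel-checked, no sorry): the parent's composition with the dial hypothesis `hd` threaded into stub 2∣cell. -/
theorem NonOrdinaryParahoricOccurrence_of
    (h₁ : open IsDedekindDomain NumberField Polynomial Filter Literature.NumberTheory.Automorphic Literature.NumberTheory.GaloisRepresentations Summit.Langlands in ∀ (K : Type) [Field K] [NumberField K], NumberField.IsCMField K → ∀ (n : ℕ) (hcpt : isCompact_glFiniteIntegralLevel n K) (π : CuspidalAutomorphicRepData n K hcpt), π.1.IsRegularAlgebraic → ∀ (p : ℕ) [Fact p.Prime] (ι : PadicAlgCl p ≃+* ℂ) (ρ : FramedGaloisRep K (PadicAlgCl p) n), ρ.toGaloisRep.IsSemisimple → (∀ᶠ v : HeightOneSpectrum (𝓞 K) in cofinite, ∀ α : Multiset ℂ, π.1.HasSatakeParamAt v α → ρ.IsUnramifiedAt v ∧ ρ.HasFrobCharpolyAt v (arithFrobPolyOfSatake ι v.residueCard n α)) → ∀ v : HeightOneSpectrum (𝓞 K), ((p : ℕ) : 𝓞 K) ∉ v.asIdeal → (∀ σ ∈ absInertia (v.adicCompletion K), (((ρ.toLocal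 v σ : GL (Fin n) (PadicAlgCl p)) : Matrix (Fin n) (Fin n) (PadicAlgCl p)) - 1) ^ n = 0) → ∃ φ ∈ π.1.W, φ ∉ π.1.W' ∧ ∀ g₁ : GL (Fin n) (v.adicCompletion K), (∀ i j : Fin n, Valued.v ((g₁ : Matrix (Fin n) (Fin n) (v.adicCompletion K)) i j) ≤ 1) → Valued.v (g₁ : Matrix (Fin n) (Fin n) (v.adicCompletion K)).det = 1 → (∀ i j : Fin n, j < i → Valued.v ((g₁ : Matrix (Fin n) (Fin n) (v.adicCompletion K)) i j) < 1) → rightTranslation (AdelicGroupData.gl n K) (GLn.ofLocal n K v g₁) φ - φ ∈ π.1.W')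
    (h₂ : open IsDedekindDomain NumberField Polynomial Filter Literature.NumberTheory.Automorphic Literature.NumberTheory.GaloisRepresentations Summit.Langlands in ∀ (K : Type) [Field K] [NumberField K], NumberField.IsCMField K → ∀ (n : ℕ) (hcpt : isCompact_glFiniteIntegralLevel n K) (π : CuspidalAutomorphicRepData n K hcpt), π.1.IsRegularAlgebraic → ∀ (p : ℕ) [Fact p.Prime] (ι : PadicAlgCl p ≃+* ℂ) (ρ : FramedGaloisRep K (PadicAlgCl p) n), ρ.toGaloisRep.IsSemisimple → (∀ᶠ v : HeightOneSpectrum (𝓞 K) in cofinite, ∀ α : Multiset ℂ, π.1.HasSatakeParamAt v α → ρ.IsUnramifiedAt v ∧ ρ.HasFrobCharpolyAt v (arithFrobPolyOfSatake ι v.residueCard n α)) → n ^ 2 < p → ¬ ((p : ℤ) ∣ NumberField.discr K) → (∀ w : HeightOneSpectrum (𝓞 K), ((p : ℕ) : 𝓞 K) ∈ w.asIdeal → π.1.IsUnramifiedAt w) → ¬ (∀ w : HeightOneSpectrum (𝓞 K), ((p : ℕ) : 𝓞 K) ∈ w.asIdeal → ∀ art : LocalArtinData (w.adicCompletion K), art.IsCanonical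 → ρ.IsOrdinaryRegularAt w art) → ∀ g : GL (Fin n) (PadicAlgCl p), (∀ (σ : Field.absoluteGaloisGroup K) (i j : Fin n), ‖((g * ρ σ * g⁻¹ : GL (Fin n) (PadicAlgCl p)) : Matrix (Fin n) (Fin n) (PadicAlgCl p)) i j‖ ≤ 1) → (∀ M : Matrix (Fin n) (Fin n) ℤ, M.det = 1 → ∃ σ : Field.absoluteGaloisGroup K, ∀ i j : Fin n, ‖((g * ρ σ * g⁻¹ : GL (Fin n) (PadicAlgCl p)) : Matrix (Fin n) (Fin n) (PadicAlgCl p)) i j - ((M i j : ℤ) : PadicAlgCl p)‖ < 1) → (∃ l : ℕ, l.Prime ∧ l ≠ p ∧ ∀ w : HeightOneSpectrum (𝓞 K), ((l : ℕ) : 𝓞 K) ∈ w.asIdeal → w.residueCard = l ∧ ρ.IsUnramifiedAt w ∧ ∃ a : Fin n → PadicAlgCl p, ρ.HasFrobCharpolyAt w (∏ i, (X - C (a i))) ∧ ∀ i j : Fin n, i ≠ j → ‖a i - a j‖ = 1 ∧ ‖a i - (l : PadicAlgCl p) * a j‖ = 1) → ∀ v : HeightOneSpectrum (𝓞 K), ((p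 : ℕ) : 𝓞 K) ∉ v.asIdeal → p ∣ (v.residueCard - 1) → (∀ (σ : Field.absoluteGaloisGroup (v.adicCompletion K)) (i j : Fin n), ‖((g * ρ.toLocal v σ * g⁻¹ : GL (Fin n) (PadicAlgCl p)) : Matrix (Fin n) (Fin n) (PadicAlgCl p)) i j - (1 : Matrix (Fin n) (Fin n) (PadicAlgCl p)) i j‖ < 1) → (∀ σ ∈ absInertia (v.adicCompletion K), (((ρ.toLocal v σ : GL (Fin n) (PadicAlgCl p)) : Matrix (Fin n) (Fin n) (PadicAlgCl p)) - 1) ^ n = 0) → ∀ W : WeilDeligneRep (v.adicCompletion K) (PadicAlgCl p) (Fin n → PadicAlgCl p), IsWeilDeligneOfLadic (ρ.toLocal v).toWeilGroupHom W → (∃ φ ∈ π.1.W, φ ∉ π.1.W' ∧ ∀ g₁ : GL (Fin n) (v.adicCompletion K), (∀ i j : Fin n, Valued.v ((g₁ : Matrix (Fin n) (Fin n) (v.adicCompletion K)) i j) ≤ 1) → Valued.v (g₁ : Matrix (Fin n) (Fin n) (v.adicCompletion K)).det = 1 → (∀ i j : Fin n, j < i → Valued.v ((g₁ : Matrix (Fin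 n) (Fin n) (v.adicCompletion K)) i j) < 1) → rightTranslation (AdelicGroupData.gl n K) (GLn.ofLocal n K v g₁) φ - φ ∈ π.1.W') → ∃ (R : Type) (_ : CommRing R) (_ : IsNoetherianRing R) (M : Type) (_ : AddCommGroup M) (_ : Module R M) (_ : Module.Finite R M) (𝔮 𝔭x : Ideal R) (_ : 𝔮.IsPrime) (_ : 𝔭x.IsPrime), 𝔮 ≤ 𝔭x ∧ Nontrivial (LocalizedModule 𝔮.primeCompl M) ∧ (Nontrivial (LocalizedModule 𝔭x.primeCompl M) → ∃ φ ∈ π.1.W, φ ∉ π.1.W' ∧ ∀ g₁ : GL (Fin n) (v.adicCompletion K), (∀ i j : Fin n, Valued.v ((g₁ : Matrix (Fin n) (Fin n) (v.adicCompletion K)) i j) ≤ 1) → Valued.v (g₁ : Matrix (Fin n) (Fin n) (v.adicCompletion K)).det = 1 → (∀ i j : Fin n, (Finset.univ.filter fun t : Fin n => n ≤ j.val + Module.finrank (PadicAlgCl p) (LinearMap.range (W.N ^ (t.val + 1)))).card < (Finset.univ.filter fun t : Fin n => n ≤ i.val + Module.finrank (PadicAlgCl p) (LinearMap.range (W.N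 ^ (t.val + 1)))).card → Valued.v ((g₁ : Matrix (Fin n) (Fin n) (v.adicCompletion K)) i j) < 1) → rightTranslation (AdelicGroupData.gl n K) (GLn.ofLocal n K v g₁) φ - φ ∈ π.1.W'))
    (h₃ : open IsDedekindDomain NumberField Polynomial Filter Literature.NumberTheory.Automorphic Literature.NumberTheory.GaloisRepresentations Summit.Langlands in ∀ (K : Type) [Field K] [NumberField K] (n : ℕ) (hcpt : isCompact_glFiniteIntegralLevel n K) (π : CuspidalAutomorphicRepData n K hcpt) (v : HeightOneSpectrum (𝓞 K)) (b : Fin n → ℕ), (∃ φ ∈ π.1.W, φ ∉ π.1.W' ∧ ∀ g₁ : GL (Fin n) (v.adicCompletion K), (∀ i j : Fin n, Valued.v ((g₁ : Matrix (Fin n) (Fin n) (v.adicCompletion K)) i j) ≤ 1) → Valued.v (g₁ : Matrix (Fin n) (Fin n) (v.adicCompletion K)).det = 1 → (∀ i j : Fin n, b j < b i → Valued.v ((g₁ : Matrix (Fin n) (Fin n) (v.adicCompletion K)) i j) < 1) → rightTranslation (AdelicGroupData.gl n K) (GLn.ofLocal n K v g₁) φ - φ ∈ π.1.W') → ∃ πv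 : SmoothIrrep (GL (Fin n) (v.adicCompletion K)), π.1.HasLocalComponentAt v πv.ρ ∧ ∃ x : πv.V, x ≠ 0 ∧ ∀ g₁ : GL (Fin n) (v.adicCompletion K), (∀ i j : Fin n, Valued.v ((g₁ : Matrix (Fin n) (Fin n) (v.adicCompletion K)) i j) ≤ 1) → Valued.v (g₁ : Matrix (Fin n) (Fin n) (v.adicCompletion K)).det = 1 → (∀ i j : Fin n, b j < b i → Valued.v ((g₁ : Matrix (Fin n) (Fin n) (v.adicCompletion K)) i j) < 1) → πv.ρ g₁ x = x) :
    NonOrdinaryParahoricOccurrence := by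
  intro K _ _ hK n hcpt π hreg p _ ι ρ hss hsat hp hdisc hunr hd g hint hbig hl v hv hq htriv hunip W hW
  have hIw := h₁ K hK n hcpt π hreg p ι ρ hss hsat v hv hunip
  obtain ⟨R, _, _, M, _, _, _, 𝔮, 𝔭x, _, _, hle, hgen, hfib⟩ :=
    h₂ K hK n hcpt π hreg p ι ρ hss hsat hp hdisc hunr hd g hint hbig hl v hv hq htriv hunip W hW hIw
  have hx : Nontrivial (LocalizedModule 𝔭x.primeCompl M) := nontrivial_localizedModule_of_le hle hgen
  exact h₃ K n hcpt π v _ (hfib hx)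

/-- The skeleton concludes the cell BY NAME from the registered stubs. -/
theorem NonOrdinaryParahoricOccurrence_of_stubs : NonOrdinaryParahoricOccurrence := NonOrdinaryParahoricOccurrence_of stub_iwahoriOccurrence stub_nonOrdinaryParahoricPatchingDatum stub_localComponentOfParahoricFixed


/-- identity with the born route decl (elaborates only AFTER birth). -/
theorem NonOrdinaryParahoricOccurrence_iff_route : NonOrdinaryParahoricOccurrence ↔ Summit.Langlands.Langlands.Theses.OrdinaryLocusCarving.NonOrdinaryParahoricOccurrence := Iff.rfl

/-- the ROUTE decl from the stubs. -/
theorem route_NonOrdinaryParahoricOccurrence_of_stubs : Summit.Langlands.Langlands.Theses.OrdinaryLocusCarving.NonOrdinaryParahoricOccurrence := NonOrdinaryParahoricOccurrence_iff_route.1 NonOrdinaryParahoricOccurrence_of_stubs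

end Summit.Langlands.Langlands.Theses.OrdinaryLocusCarving.Birth.NonOrdinaryParahoricOccurrence
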